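import Literature.NumberTheory.EllipticCurves.KubertTateSeven
import HarnessLib

/-!
# Kubert's raw form of `X₁(7)`: on the Tate normal form `E(b, c)`, `7 · (0,0) = 𝒪 ⟺ b² − bc = c³`,
# and every marked curve with a point of order `7` is an `E(d³ − d², d² − d)`

PROOF-ONLY file (theorems only), topic `NumberTheory/EllipticCurves`; completes `KubertTateSeven` (which
shows that `(0,0)` has order `7` on `E(d·d·(d−1), d(d−1))`) by the CONVERSE, i.e. the universality of the
`X₁(7)`-family (Kubert 1976, Table 3, `N = 7`; Knapp §V.5 for the method): on `E(b, c)` with `P = (0,0)`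
nonsingular and `c ≠ 0` (i.e. `4P ≠ 𝒪`),

* `kubertTate_four_nsmul_zero_of_ne` — `4P = 3P + P` in closed form (chord through `3P = (c, b − c)` and `P`,
  slope `(b − c)/c`; tree `kubertTate_some_add_some_zero`);
* **`kubertTate_seven_nsmul_zero_iff`** — `7P = 𝒪 ⟺ b² − bc = c³` (`7P = 𝒪 ⟺ 4P = −3P = (c, c²) ⟺ x(4P) = c`,
  and `x(4P) = c ⟺ (b−c)² + (1−c)(b−c)c + (b−2c)c² = 0 ⟺ b² − bc − c³ = 0`);
* `kubertTate_eq_diag₇_of_addOrderOf_eq_seven` — if `(0,0)` has order `7` on `E(b, c)` then `c ≠ 0` and, with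
  `d = b/c`, `b = d·d·(d−1)` and `c = d(d−1)` (from `c³ = b(b − c)`: `c = d(d − 1)`), so
  `E(b, c) = E(d·d·(d−1), d(d−1))` with `d ≠ 0, 1`;
* **`exists_variableChange_eq_kubertTate_diag₇_of_addOrderOf_eq_seven`** — every Weierstrass curve `W/F`
  with a nonsingular point `P` of order `7` is carried by an admissible change of variables onto some
  `E(d·d·(d−1), d(d−1))`, `d ≠ 0, 1`, with `P ↦ (0,0)` (Knapp's reduction
  `exists_variableChange_pointEquiv_eq_zero`, then the raw form).

So "elliptic curve over `F` with a rational point of order `7`" and "`E_{m,n} = kubertTateSeven m n` up to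
`F`-isomorphism" are the same class (over `ℚ`: `d = m/n`, `kubertTateSeven_eq_variableChange_kubertTate`),
which is what makes the class-wide `7`-descent of `KubertTateSevenMuDescent` a statement about ALL elliptic
curves over `ℚ` with `E(ℚ)[7] ≠ 0`.

## References

* [Kubert1976] D. S. Kubert, *Universal bounds on the torsion of elliptic curves*, Proc. London Math. Soc. (3)
  33 (1976) 193–237, Table 3 (`N = 7`: `b = d³ − d²`, `c = d² − d`).
* [Knapp1993] A. W. Knapp, *Elliptic Curves*, §V.5 (5.30)–(5.31) and pp. 146–147.
* [Sutherland2012] A. V. Sutherland, Math. Comp. 81 (2012), §2 (raw forms of `X₁(N)`).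
-/

noncomputable section

namespace WeierstrassCurve

section Field

variable {F : Type*} [Field F] [DecidableEq F]

omit [DecidableEq F] in
/-- Two affine points with equal coordinates are equal (proof-irrelevance helper). [folklore] -/
private theorem kubertTate₇_point_congr {W : WeierstrassCurve F} {x y x' y' : F}
    {h : W.toAffine.Nonsingular x y} {h' : W.toAffine.Nonsingular x' y'} (hx : x = x') (hy : y = y') :
    (Affine.Point.some x y h : W.toAffine.Point) = Affine.Point.some x' y' h' := by
  subst hx hy
  rfl

/-- **`4P = 3P + P` on `E(b, c)` for `c ≠ 0`**: with `λ = (b − c)/c` (the chord through `3P = (c, b − c)` and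
`P = (0,0)`), `4P = (λ² + (1−c)λ + b − c, −(λ + 1 − c)(λ² + (1−c)λ + b − c) + b)`.
[cite: Knapp1993, §V.5 (5.30b)] [cite: Sutherland2012, §2] -/
theorem kubertTate_four_nsmul_zero_of_ne (b c : F) (h : (kubertTate b c).toAffine.Nonsingular 0 0)
    (hc : c ≠ 0) :
    ∃ h₄, 4 • (Affine.Point.some 0 0 h : (kubertTate b c).toAffine.Point) =
      Affine.Point.some (((b - c) / c) ^ 2 + (1 - c) * ((b - c) / c) + b - c)
        (-(((b - c) / c + (1 - c)) * (((b - c) / c) ^ 2 + (1 - c) * ((b - c) / c) + b - c)) + b) h₄ := by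
  rw [show (4 : ℕ) = 3 + 1 from rfl, succ_nsmul, kubertTate_three_nsmul_zero b c h]
  exact kubertTate_some_add_some_zero b c
    (kubertTate_nonsingular_three b c ((kubertTate_nonsingular_zero_iff b c).mp h)) h hc

/-- **`-3P = (c, c²)`** on `E(b, c)` (`3P = (c, b − c)`, `−(x, y) = (x, −y − (1−c)x + b)`).
[cite: Knapp1993, §V.5 (5.30b)] -/
theorem kubertTate_neg_three_nsmul_zero (b c : F) (h : (kubertTate b c).toAffine.Nonsingular 0 0) :
    ∃ h₃', -(3 • (Affine.Point.some 0 0 h : (kubertTate b c).toAffine.Point)) = Affine.Point.some c (c ^ 2) h₃' := by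
  have hneg : (kubertTate b c).toAffine.negY c (b - c) = c ^ 2 := by
    simp only [Affine.negY, kubertTate]
    ring
  have h₃ := kubertTate_nonsingular_three b c ((kubertTate_nonsingular_zero_iff b c).mp h)
  have h₃' : (kubertTate b c).toAffine.Nonsingular c (c ^ 2) := by
    have := (Affine.nonsingular_neg (W' := (kubertTate b c).toAffine) c (b - c)).mpr h₃
    rwa [hneg] at this
  refine ⟨h₃', ?_⟩
  rw [kubertTate_three_nsmul_zero b c h, Affine.Point.neg_some]
  exact kubertTate₇_point_congr rfl hneg

/-- **Kubert's raw form of `X₁(7)`: `7P = 𝒪 ⟺ b² − bc = c³`** for `P = (0, 0)` nonsingular on `E(b, c)` with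
`c ≠ 0` (`7P = 𝒪 ⟺ 4P = −3P`; comparing abscissae, `x(4P) = c ⟺ b² − bc − c³ = 0`, and then the ordinates
agree automatically). [cite: Kubert1976, Table 3 (N = 7)] [cite: Sutherland2012, §2 (raw form of X₁(7))] -/
theorem kubertTate_seven_nsmul_zero_iff (b c : F) (h : (kubertTate b c).toAffine.Nonsingular 0 0)
    (hc : c ≠ 0) :
    7 • (Affine.Point.some 0 0 h : (kubertTate b c).toAffine.Point) = 0 ↔ b ^ 2 - b * c = c ^ 3 := by
  set P : (kubertTate b c).toAffine.Point := Affine.Point.some 0 0 h with hP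
  have key : (7 : ℕ) • P = 0 ↔ (4 : ℕ) • P = -((3 : ℕ) • P) := by
    rw [show (7 : ℕ) • P = (4 : ℕ) • P + (3 : ℕ) • P by rw [← add_nsmul], add_eq_zero_iff_eq_neg]
  obtain ⟨h₄, e₄⟩ := kubertTate_four_nsmul_zero_of_ne b c h hc
  obtain ⟨h₃', e₃⟩ := kubertTate_neg_three_nsmul_zero b c h
  rw [key, hP, e₄, e₃]
  constructor
  · intro hh
    have hx := ((Affine.Point.some.injEq _ _ _ _ _ _).mp hh).1
    field_simp at hx
    linear_combination hx
  · intro hbc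
    have hx : ((b - c) / c) ^ 2 + (1 - c) * ((b - c) / c) + b - c = c := by
      field_simp
      linear_combination hbc
    apply kubertTate₇_point_congr hx
    rw [hx]
    field_simp
    ring

/-- On `E(b, c)` with `(0,0)` of order `7`, `c ≠ 0` (else `3P = (0, b) = −P` and `P` has order `4`).
[cite: Knapp1993, §V.5 (5.31)] -/
theorem kubertTate_c_ne_zero_of_addOrderOf_eq_seven (b c : F) (h : (kubertTate b c).toAffine.Nonsingular 0 0)
    (h7 : addOrderOf (Affine.Point.some 0 0 h : (kubertTate b c).toAffine.Point) = 7) : c ≠ 0 := by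
  intro hc
  have h4 : 4 • (Affine.Point.some 0 0 h : (kubertTate b c).toAffine.Point) = 0 := by
    rw [show (4 : ℕ) = 3 + 1 from rfl, succ_nsmul, kubertTate_three_nsmul_zero b c h]
    have e : (Affine.Point.some c (b - c) (kubertTate_nonsingular_three b c
        ((kubertTate_nonsingular_zero_iff b c).mp h)) : (kubertTate b c).toAffine.Point) =
        -(Affine.Point.some 0 0 h) := by
      rw [kubertTate_neg_zero]
      exact kubertTate₇_point_congr hc (by rw [hc, sub_zero])
    rw [e, neg_add_cancel]
  have hdvd : addOrderOf (Affine.Point.some 0 0 h : (kubertTate b c).toAffine.Point) ∣ 4 :=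
    addOrderOf_dvd_of_nsmul_eq_zero h4
  rw [h7] at hdvd
  omega

/-- **If `(0, 0)` has order `7` on `E(b, c)` then `E(b, c) = E(d·d·(d−1), d(d−1))` with `d = b/c ≠ 0, 1`**
(`c³ = b(b − c)` gives `c = d(d−1)` and `b = cd`). [cite: Kubert1976, Table 3 (N = 7)] -/
theorem kubertTate_eq_diag₇_of_addOrderOf_eq_seven (b c : F) (h : (kubertTate b c).toAffine.Nonsingular 0 0)
    (h7 : addOrderOf (Affine.Point.some 0 0 h : (kubertTate b c).toAffine.Point) = 7) :
    b = (b / c) * (b / c) * (b / c - 1) ∧ c = (b / c) * (b / c - 1) ∧ b / c ≠ 0 ∧ b / c ≠ 1 := by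
  have hb : b ≠ 0 := (kubertTate_nonsingular_zero_iff b c).mp h
  have hc : c ≠ 0 := kubertTate_c_ne_zero_of_addOrderOf_eq_seven b c h h7
  have hrel : b ^ 2 - b * c = c ^ 3 :=
    (kubertTate_seven_nsmul_zero_iff b c h hc).mp (h7 ▸ addOrderOf_nsmul_eq_zero _)
  have hc' : c = (b / c) * (b / c - 1) := by
    field_simp
    linear_combination -hrel
  refine ⟨?_, hc', div_ne_zero hb hc, ?_⟩
  · calc b = (b / c) * c := by field_simp
      _ = (b / c) * ((b / c) * (b / c - 1)) := by rw [← hc']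
      _ = (b / c) * (b / c) * (b / c - 1) := by ring
  · intro h1
    apply hc
    rw [hc', h1, sub_self, mul_zero]

/-- **Every marked curve with a point of order `7` is an `E(d³ − d², d² − d)`** (Kubert, Table 3, `N = 7`):
for a nonsingular affine point `(x, y)` of order `7` on `W/F` there are `d : F` (`d ≠ 0, 1`) and an admissible
change of variables `C` with `C • W = E(d·d·(d−1), d(d−1))` whose induced group isomorphism maps `(x, y)` to
`(0, 0)`. [cite: Kubert1976, Table 3 (N = 7)] [cite: Knapp1993, §V.5 pp. 146–147] -/
theorem exists_variableChange_eq_kubertTate_diag₇_of_addOrderOf_eq_seven (W : WeierstrassCurve F)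
    {x y : F} (h : W.toAffine.Nonsingular x y) (h7 : addOrderOf (Affine.Point.some x y h) = 7) :
    ∃ (d : F) (C : VariableChange F) (hC : C • W = kubertTate (d * d * (d - 1)) (d * (d - 1)))
      (h₀ : (kubertTate (d * d * (d - 1)) (d * (d - 1))).toAffine.Nonsingular 0 0), d ≠ 0 ∧ d ≠ 1 ∧
      Affine.Point.congrEquiv hC (VariableChange.pointEquiv W C (.some x y h)) = .some 0 0 h₀ := by
  have hk : ∀ k : ℕ, k • Affine.Point.some x y h = 0 → 7 ∣ k := fun k hk =>
    h7 ▸ addOrderOf_dvd_of_nsmul_eq_zero hk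
  have h₂ : 2 • Affine.Point.some x y h ≠ 0 := fun e => by have := hk 2 e; omega
  have h₃ : 3 • Affine.Point.some x y h ≠ 0 := fun e => by have := hk 3 e; omega
  obtain ⟨b, c, C, hC, h₀, hP⟩ := exists_variableChange_pointEquiv_eq_zero W h h₂ h₃
  have h7' : addOrderOf (Affine.Point.some 0 0 h₀ : (kubertTate b c).toAffine.Point) = 7 := by
    rw [← hP, AddEquiv.addOrderOf_eq, AddEquiv.addOrderOf_eq, h7]
  obtain ⟨hb, hc, hd0, hd1⟩ := kubertTate_eq_diag₇_of_addOrderOf_eq_seven b c h₀ h7'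
  set d := b / c with hd
  have hbc : kubertTate b c = kubertTate (d * d * (d - 1)) (d * (d - 1)) := by
    rw [← hb, ← hc]
  refine ⟨d, C, hC.trans hbc, hbc ▸ h₀, hd0, hd1, ?_⟩
  -- transport the marked point along the (definitional) rewriting of the target curve
  have key : ∀ (V : WeierstrassCurve F) (e : kubertTate b c = V) (hV : C • W = V)
      (h₀' : V.toAffine.Nonsingular 0 0),
      Affine.Point.congrEquiv hV (VariableChange.pointEquiv W C (.some x y h)) = .some 0 0 h₀' := by
    intro V e hV h₀'
    subst e
    rw [hP]
  exact key _ hbc (hC.trans hbc) _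

end Field

end WeierstrassCurve

end
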